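import Summits.CriticalPhenomena.PercolationContinuityZ3.Theorems.PercNearOneGluingNoHeavyLowerTailSahiCombTriWSandwich

/-!
# The SATURATED stratum of `TRI_W(a)`: every up-set `P` with `P ∪ refl P = W` satisfies `TriWIneq` for EVERY index cube, by an explicit sandwich certificate

Support file of the one-cut programme (crux `NoHeavyLowerTail`, stmt-CriticalPhenomena-4575; TRI lane of cell `prim-masterthm`; seat prim-lf-1 gen 39,
memo `FROM-prim-lf-1-gen39-SATURATED-STRATUM.md`).  Continuation of `…SahiCombTriWSandwich` (P5 gen 24: the sandwich form of the pair-local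
principle, `triW_nonneg_of_sandwichPt`) and `…SahiCombFiveUpSetProof` (the five-up-set theorem `fiveUpSetIneq_holds`).

Call an up-set `P ⊆ W = Finset γ` SATURATED if every point or its complement lies in `P` (`∀ e, e ∈ P ∨ eᶜ ∈ P`, i.e. `P ∪ refl P = W`;
equivalently `P` contains a maximal intersecting family; e.g. every `P ∋ {i}`, every `P = W \ ↓M` with `M ≠ univ`, every self-dual `P`, the majority
family; 81 of the 167 non-empty up-sets of `2^4`).  Write `Q = P ∩ refl P` (the self-dual part) and `P₁ = P \ refl P`.  The FORMULA-A point weight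

  `κ_A(t, tᶜ) = 1 (t ∈ Q)`,  `κ_A(t, t) = 1 (t ∈ P₁)`,   i.e.   `κ_A(A × B) = #(Q ∩ A ∩ refl B) + #(P₁ ∩ A ∩ B)`   (`FiveUpSet.kapA`, `ptVal_kapA`)

is a sandwich certificate (`c = 1`) for every saturated `P`:

* UPPER bound (`FiveUpSet.ptVal_kapA_le_uForm`, for EVERY up-set `P`, saturated or not):
  `U_P(A,B) − κ_A(A×B) = #(P∩A∩B) − #((refl P \ P)∩A∩B) − #(Q∩A∩refl B) ≥ 0` — this IS the five-up-set inequality for the test up-set `A` and the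
  nested pairs `P \ refl P ⊆ P`, `∅ ⊆ B` (`fiveUpSetIneq_holds`);
* LOWER bound (`FiveUpSet.lForm_le_ptVal_kapA`, saturated `P`): `κ_A(A×B) − L_P(A,B) = #(A∩B) − #(A∩refl B) ≥ 0` — Kleitman's lemma.
Hence (`FiveUpSet.sandwichPt_kapA_of_saturated`, **`FiveUpSet.triW_nonneg_of_saturated`**) `0 ≤ triW P F G` for every saturated up-set `P`, EVERY
index cube `Finset β` and all monotone families of up-sets `F, G` — `TriWIneq` on the saturated stratum, all `n`, all `a`.  Corollaries: `P ∋ {i}`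
(`triW_nonneg_of_singleton_mem`, contains every principal `↑{i}` and every `P ⊇ ↑{i}`), co-faces `W \ ↓M` (`triW_nonneg_coface`, contains the punctured
cube of `…TriWPunctured`).  For non-saturated `P` (some pair `e, eᶜ ∉ P`, e.g. `↑01 ∪ ↑02`, `K₂₂`) the lower bound acquires the extra term
`−(#(Z∩A∩B) − #(Z∩A∩refl B))`, `Z = W \ (P ∪ refl P)`, and `κ_A` fails in general (memo §2): that is where the open part of `PairLocalKleitman` lives.
HONEST LABEL: complete proofs, std axioms; a new unconditional stratum of `TriWIneq` (all `n`, all `a`); `TriWIneq` itself stays OPEN. [this work]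
-/

namespace Summit.CriticalPhenomena.PercolationContinuityZ3.Theorems

namespace FiveUpSet

open Finset

variable {β γ : Type} [DecidableEq β] [Fintype β] [DecidableEq γ] [Fintype γ]

/-! ### The Formula-A weight and its value on a pair of families -/

/-- **Formula A.**  The point weight `κ_A`: an antidiagonal unit `(t, tᶜ)` for every `t` in the self-dual part `P ∩ refl P`, a diagonal unit `(t,t)`
for every `t ∈ P \ refl P`. [this work] -/
def kapA (P : Finset (Finset γ)) (u e : Finset γ) : ℕ :=
  if u ∈ P then (if uᶜ ∈ P then (if e = uᶜ then 1 else 0) else (if e = u then 1 else 0)) else 0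

omit [DecidableEq β] [Fintype β] in
/-- Collapse of the certificate double sum for `κ_A`:
`Σ_u Σ_e κ_A(u,e)·x(u)·y(e) = Σ_{u ∈ P ∩ refl P} x(u)·y(uᶜ) + Σ_{u ∈ P \ refl P} x(u)·y(u)`. [this work] -/
theorem sum_sum_kapA (P : Finset (Finset γ)) (x y : Finset γ → ℤ) :
    ∑ u : Finset γ, ∑ e : Finset γ, (kapA P u e : ℤ) * x u * y e
      = ∑ u ∈ P ∩ refl P, x u * y uᶜ + ∑ u ∈ P \ refl P, x u * y u := by
  have hin : ∀ u : Finset γ, ∑ e : Finset γ, (kapA P u e : ℤ) * x u * y e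
      = (if u ∈ P ∩ refl P then x u * y uᶜ else 0) + (if u ∈ P \ refl P then x u * y u else 0) := by
    intro u
    by_cases hu : u ∈ P
    · by_cases hc : uᶜ ∈ P
      · have h1 : u ∈ P ∩ refl P := mem_inter.2 ⟨hu, mem_refl.2 hc⟩
        have h2 : u ∉ P \ refl P := fun h => (mem_sdiff.1 h).2 (mem_refl.2 hc)
        simp only [kapA, hu, hc, h1, h2, if_true, if_false, add_zero]
        rw [Finset.sum_eq_single uᶜ]
        · simp
        · intro e _ he; simp [he]
        · intro h; exact absurd (mem_univ _) h
      · have h1 : u ∉ P ∩ refl P := fun h => hc (mem_refl.1 (mem_inter.1 h).2)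
        have h2 : u ∈ P \ refl P := mem_sdiff.2 ⟨hu, fun h => hc (mem_refl.1 h)⟩
        simp only [kapA, hu, hc, h1, h2, if_true, if_false, zero_add]
        rw [Finset.sum_eq_single u]
        · simp
        · intro e _ he; simp [he]
        · intro h; exact absurd (mem_univ _) h
    · have h1 : u ∉ P ∩ refl P := fun h => hu (mem_inter.1 h).1
      have h2 : u ∉ P \ refl P := fun h => hu (mem_sdiff.1 h).1
      simp [kapA, hu, h1, h2]
  rw [Finset.sum_congr rfl (fun u _ => hin u), sum_add_distrib]
  congr 1
  · rw [← Finset.sum_filter]; congr 1; ext u; simp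
  · rw [← Finset.sum_filter]; congr 1; ext u; simp

omit [DecidableEq β] [Fintype β] in
/-- **The value of `κ_A` on a pair of families**: `κ_A(A × B) = #(P ∩ refl P ∩ A ∩ refl B) + #((P \ refl P) ∩ A ∩ B)`. [this work] -/
theorem ptVal_kapA (P A B : Finset (Finset γ)) :
    ptVal (kapA P) A B = ((P ∩ refl P ∩ A ∩ refl B).card : ℤ) + ((P \ refl P) ∩ A ∩ B).card := by
  unfold ptVal
  rw [sum_sum_kapA P (fun u => if u ∈ A then (1 : ℤ) else 0) (fun e => if e ∈ B then (1 : ℤ) else 0)]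
  have h1 : ∑ u ∈ P ∩ refl P, (if u ∈ A then (1 : ℤ) else 0) * (if uᶜ ∈ B then (1 : ℤ) else 0)
      = ((P ∩ refl P ∩ A ∩ refl B).card : ℤ) := by
    have : ∀ u, (if u ∈ A then (1 : ℤ) else 0) * (if uᶜ ∈ B then (1 : ℤ) else 0) = if u ∈ A ∩ refl B then 1 else 0 := by
      intro u; by_cases ha : u ∈ A <;> by_cases hb : uᶜ ∈ B <;> simp [ha, hb, mem_refl]
    rw [Finset.sum_congr rfl (fun u _ => this u), Finset.sum_boole]
    simp only [filter_mem_eq_inter, inter_assoc]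
  have h2 : ∑ u ∈ P \ refl P, (if u ∈ A then (1 : ℤ) else 0) * (if u ∈ B then (1 : ℤ) else 0)
      = (((P \ refl P) ∩ A ∩ B).card : ℤ) := by
    have : ∀ u, (if u ∈ A then (1 : ℤ) else 0) * (if u ∈ B then (1 : ℤ) else 0) = if u ∈ A ∩ B then 1 else 0 := by
      intro u; by_cases ha : u ∈ A <;> by_cases hb : u ∈ B <;> simp [ha, hb]
    rw [Finset.sum_congr rfl (fun u _ => this u), Finset.sum_boole]
    simp only [filter_mem_eq_inter, inter_assoc]
  rw [h1, h2]

/-! ### The upper bound: a five-up-set inequality (every up-set `P`) -/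

omit [DecidableEq β] [Fintype β] in
/-- **`κ_A(A×B) ≤ U_P(A,B)` for EVERY up-set `P` and all up-sets `A, B`.**  The difference is
`#(P∩A∩B) − #((refl P \ P)∩A∩B) − #(P∩refl P∩A∩refl B)`, non-negative by the five-up-set theorem for the test up-set `A` and the nested pairs
`P \ refl P ⊆ P`, `∅ ⊆ B` (note `refl (P \ refl P) = refl P \ P`, `refl (P ∩ refl P) = P ∩ refl P`). [this work] -/
theorem ptVal_kapA_le_uForm {P A B : Finset (Finset γ)} (hP : IsUpperSet (P : Set (Finset γ)))
    (hA : IsUpperSet (A : Set (Finset γ))) (hB : IsUpperSet (B : Set (Finset γ))) :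
    ptVal (kapA P) A B ≤ uForm P A B := by
  -- the up-set `P \ refl P`
  have hP1 : IsUpperSet ((P \ refl P : Finset (Finset γ)) : Set (Finset γ)) := by
    rw [coe_sdiff]; exact hP.sdiff_of_isLowerSet (isLowerSet_refl hP)
  have hE : IsUpperSet ((∅ : Finset (Finset γ)) : Set (Finset γ)) := by rw [coe_empty]; exact isUpperSet_empty
  have h5 := fiveUpSetIneq_holds γ A (P \ refl P) P ∅ B hA hP1 hP hE hB sdiff_subset (empty_subset B)
  -- simplify the five sets
  have e0 : refl (∅ : Finset (Finset γ)) = ∅ := Finset.map_empty _   -- `LatticeFiveUpSet.refl_empty_family`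
  have e1 : A ∩ P ∩ refl (∅ : Finset (Finset γ)) = ∅ := by rw [e0, inter_empty]
  have e2 : refl (P \ refl P) = refl P \ P := by rw [refl_sdiff, refl_refl]
  have e3 : P \ (P \ refl P) = P ∩ refl P := sdiff_sdiff_right_self
  have e4 : refl (P ∩ refl P) = P ∩ refl P := by rw [refl_inter, refl_refl, inter_comm]
  have e5 : A ∩ (P \ refl P) ∩ (∅ : Finset (Finset γ)) = ∅ := inter_empty _
  rw [e1, e2, e3, e4, sdiff_empty, e5, card_empty, zero_add, add_zero] at h5
  -- `h5 : #(A ∩ (refl P \ P) ∩ B) + #(A ∩ (P ∩ refl P) ∩ refl B) ≤ #(A ∩ P ∩ B)`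
  rw [ptVal_kapA]
  unfold uForm
  -- cardinal bookkeeping: `#(refl P ∩ A ∩ B) = #((refl P \ P) ∩ A ∩ B) + #(P ∩ refl P ∩ A ∩ B)` and `#(P∩A∩B) = #((P\refl P)∩A∩B) + #(P∩refl P∩A∩B)`
  have c1 : (refl P ∩ A ∩ B).card = ((refl P \ P) ∩ A ∩ B).card + (P ∩ refl P ∩ A ∩ B).card := by
    rw [← card_union_of_disjoint]
    · congr 1; ext s; simp only [mem_inter, mem_union, mem_sdiff]; tauto
    · rw [disjoint_left]; intro s h1 h2
      simp only [mem_inter, mem_sdiff] at h1 h2; exact h1.1.1.2 h2.1.1.1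
  have c2 : (P ∩ A ∩ B).card = ((P \ refl P) ∩ A ∩ B).card + (P ∩ refl P ∩ A ∩ B).card := by
    rw [← card_union_of_disjoint]
    · congr 1; ext s; simp only [mem_inter, mem_union, mem_sdiff]; tauto
    · rw [disjoint_left]; intro s h1 h2
      simp only [mem_inter, mem_sdiff] at h1 h2; exact h1.1.1.2 h2.1.1.2
  have c3 : (A ∩ (refl P \ P) ∩ B).card = ((refl P \ P) ∩ A ∩ B).card := by
    congr 1; ext s; simp only [mem_inter]; tauto
  have c4 : (A ∩ (P ∩ refl P) ∩ refl B).card = (P ∩ refl P ∩ A ∩ refl B).card := by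
    congr 1; ext s; simp only [mem_inter]; tauto
  have c5 : (A ∩ P ∩ B).card = (P ∩ A ∩ B).card := by
    congr 1; ext s; simp only [mem_inter]; tauto
  rw [c3, c4, c5] at h5
  have h5' : (((refl P \ P) ∩ A ∩ B).card : ℤ) + (P ∩ refl P ∩ A ∩ refl B).card ≤ (P ∩ A ∩ B).card := by exact_mod_cast h5
  have c1' : ((refl P ∩ A ∩ B).card : ℤ) = ((refl P \ P) ∩ A ∩ B).card + (P ∩ refl P ∩ A ∩ B).card := by exact_mod_cast c1
  have c2' : ((P ∩ A ∩ B).card : ℤ) = ((P \ refl P) ∩ A ∩ B).card + (P ∩ refl P ∩ A ∩ B).card := by exact_mod_cast c2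
  linarith

/-! ### The lower bound for saturated `P`: Kleitman's lemma -/

omit [DecidableEq β] [Fintype β] in
/-- **`L_P(A,B) ≤ κ_A(A×B)` for SATURATED `P`** (`∀ e, e ∈ P ∨ eᶜ ∈ P`): the difference is exactly the Kleitman gap `#(A∩B) − #(A∩refl B) ≥ 0`. [this work] -/
theorem lForm_le_ptVal_kapA {P A B : Finset (Finset γ)} (hsat : ∀ e : Finset γ, e ∈ P ∨ eᶜ ∈ P)
    (hA : IsUpperSet (A : Set (Finset γ))) (hB : IsUpperSet (B : Set (Finset γ))) :
    lForm P A B ≤ ptVal (kapA P) A B := by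
  rw [ptVal_kapA]
  unfold lForm
  have hk := card_inter_refl_le hA hB   -- `#(A ∩ refl B) ≤ #(A ∩ B)`
  -- `#(P ∩ refl A ∩ B) = #(refl P ∩ A ∩ refl B)` (antipodal image)
  have r1 : (P ∩ refl A ∩ B).card = (refl P ∩ A ∩ refl B).card := by
    rw [← card_refl (P ∩ refl A ∩ B), refl_inter, refl_inter, refl_refl]
  -- saturation: `refl P ∩ S` and `(P \ refl P) ∩ S` partition `S`; `P ∩ S` and `refl P ∩ S` cover `S` with overlap `P ∩ refl P ∩ S`
  have hcov : ∀ s : Finset γ, s ∈ P ∨ s ∈ refl P := fun s => by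
    rcases hsat s with h | h
    · exact Or.inl h
    · exact Or.inr (mem_refl.2 h)
  have c1 : (refl P ∩ A ∩ refl B).card + (P ∩ A ∩ refl B).card = (A ∩ refl B).card + (P ∩ refl P ∩ A ∩ refl B).card := by
    have hu : refl P ∩ A ∩ refl B ∪ P ∩ A ∩ refl B = A ∩ refl B := by
      ext s; simp only [mem_union, mem_inter]
      constructor
      · rintro (⟨⟨-, h1⟩, h2⟩ | ⟨⟨-, h1⟩, h2⟩) <;> exact ⟨h1, h2⟩
      · rintro ⟨h1, h2⟩; rcases hcov s with h | h
        · exact Or.inr ⟨⟨h, h1⟩, h2⟩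
        · exact Or.inl ⟨⟨h, h1⟩, h2⟩
    have hi : refl P ∩ A ∩ refl B ∩ (P ∩ A ∩ refl B) = P ∩ refl P ∩ A ∩ refl B := by
      ext s; simp only [mem_inter]; tauto
    have := card_union_add_card_inter (refl P ∩ A ∩ refl B) (P ∩ A ∩ refl B)
    rw [hu, hi] at this
    omega
  have c2 : (refl P ∩ A ∩ B).card + ((P \ refl P) ∩ A ∩ B).card = (A ∩ B).card := by
    rw [← card_union_of_disjoint]
    · congr 1; ext s; simp only [mem_union, mem_inter, mem_sdiff]
      constructor
      · rintro (⟨⟨-, h1⟩, h2⟩ | ⟨⟨⟨-, -⟩, h1⟩, h2⟩) <;> exact ⟨h1, h2⟩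
      · rintro ⟨h1, h2⟩
        by_cases h : s ∈ refl P
        · exact Or.inl ⟨⟨h, h1⟩, h2⟩
        · rcases hcov s with h' | h'
          · exact Or.inr ⟨⟨⟨h', h⟩, h1⟩, h2⟩
          · exact absurd h' h
    · rw [disjoint_left]; intro s h1 h2
      simp only [mem_inter, mem_sdiff] at h1 h2; exact h2.1.1.2 h1.1.1
  rw [r1]
  have c1' : ((refl P ∩ A ∩ refl B).card : ℤ) + (P ∩ A ∩ refl B).card = (A ∩ refl B).card + (P ∩ refl P ∩ A ∩ refl B).card := by
    exact_mod_cast c1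
  have c2' : ((refl P ∩ A ∩ B).card : ℤ) + ((P \ refl P) ∩ A ∩ B).card = (A ∩ B).card := by exact_mod_cast c2
  have hk' : ((A ∩ refl B).card : ℤ) ≤ (A ∩ B).card := by exact_mod_cast hk
  linarith

/-! ### The saturated stratum -/

omit [DecidableEq β] [Fintype β] in
/-- **Formula A is a sandwich certificate for every saturated up-set.** [this work] -/
theorem sandwichPt_kapA_of_saturated {P : Finset (Finset γ)} (hP : IsUpperSet (P : Set (Finset γ)))
    (hsat : ∀ e : Finset γ, e ∈ P ∨ eᶜ ∈ P) : SandwichPt P 1 (kapA P) := by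
  intro A B hA hB
  refine ⟨?_, ?_⟩
  · rw [Nat.cast_one, one_mul]; exact lForm_le_ptVal_kapA hsat hA hB
  · rw [Nat.cast_one, one_mul]; exact ptVal_kapA_le_uForm hP hA hB

/-- **`TriWIneq` ON THE SATURATED STRATUM.**  If the up-set `P` contains every point or its complement (`∀ e, e ∈ P ∨ eᶜ ∈ P`), then
`0 ≤ triW P F G` for EVERY index cube `Finset β` and all monotone families `F, G` of up-sets of `Finset γ` (all `n`, all `a`).
Proof: sandwich principle (`triW_nonneg_of_sandwichPt`) with the Formula-A weight; upper bound = five-up-set theorem, lower bound = Kleitman. [this work] -/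
theorem triW_nonneg_of_saturated {P : Finset (Finset γ)} (hP : IsUpperSet (P : Set (Finset γ)))
    (hsat : ∀ e : Finset γ, e ∈ P ∨ eᶜ ∈ P) (F G : Finset β → Finset (Finset γ))
    (hF : ∀ x, IsUpperSet (F x : Set (Finset γ))) (hG : ∀ x, IsUpperSet (G x : Set (Finset γ)))
    (hFm : Monotone F) (hGm : Monotone G) :
    0 ≤ triW P F G :=
  triW_nonneg_of_sandwichPt Nat.one_pos (sandwichPt_kapA_of_saturated hP hsat) F G hF hG hFm hGm

/-! ### Corollaries: families containing a singleton, co-faces -/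

/-- **Up-sets containing a singleton** (`{i} ∈ P`, e.g. every `P ⊇ ↑{i}`, in particular the principal up-set `↑{i}` itself) are saturated, hence satisfy
`TriWIneq` for every index cube. [this work] -/
theorem triW_nonneg_of_singleton_mem {P : Finset (Finset γ)} (hP : IsUpperSet (P : Set (Finset γ))) {i : γ} (hi : ({i} : Finset γ) ∈ P)
    (F G : Finset β → Finset (Finset γ))
    (hF : ∀ x, IsUpperSet (F x : Set (Finset γ))) (hG : ∀ x, IsUpperSet (G x : Set (Finset γ)))
    (hFm : Monotone F) (hGm : Monotone G) :
    0 ≤ triW P F G := by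
  refine triW_nonneg_of_saturated hP (fun e => ?_) F G hF hG hFm hGm
  by_cases h : i ∈ e
  · exact Or.inl (hP (show ({i} : Finset γ) ≤ e from singleton_subset_iff.2 h) hi)
  · exact Or.inr (hP (show ({i} : Finset γ) ≤ eᶜ from singleton_subset_iff.2 (mem_compl.2 h)) hi)

/-- **Co-faces.**  For `M ≠ univ` the up-set `W \ ↓M = {e | ¬ e ⊆ M}` (the punctured cube for `M = ∅`, the principal up-set `↑{i}` for `M = univ \ {i}`)
is saturated, hence satisfies `TriWIneq` for every index cube. [this work] -/
theorem triW_nonneg_coface {M : Finset γ} (hM : M ≠ univ) (F G : Finset β → Finset (Finset γ))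
    (hF : ∀ x, IsUpperSet (F x : Set (Finset γ))) (hG : ∀ x, IsUpperSet (G x : Set (Finset γ)))
    (hFm : Monotone F) (hGm : Monotone G) :
    0 ≤ triW (univ.filter fun e : Finset γ => ¬ e ⊆ M) F G := by
  have hP : IsUpperSet ((univ.filter fun e : Finset γ => ¬ e ⊆ M : Finset (Finset γ)) : Set (Finset γ)) := by
    intro a b hab ha
    rw [mem_coe, mem_filter] at ha ⊢
    exact ⟨mem_univ _, fun hb => ha.2 (le_trans hab hb)⟩
  refine triW_nonneg_of_saturated hP (fun e => ?_) F G hF hG hFm hGm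
  by_cases h : e ⊆ M
  · right
    rw [mem_filter]
    refine ⟨mem_univ _, fun hc => hM ?_⟩
    -- `e ⊆ M` and `eᶜ ⊆ M` force `M = univ`
    exact eq_univ_of_forall fun j => by
      by_cases hj : j ∈ e
      · exact h hj
      · exact hc (mem_compl.2 hj)
  · left; rw [mem_filter]; exact ⟨mem_univ _, h⟩

end FiveUpSet

end Summit.CriticalPhenomena.PercolationContinuityZ3.Theorems
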